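import Mathlib
import HarnessLib.Audit
import Summits.PneNP.PneNP.Theorems.PstarUnion

/-!
# ONE CROSS GATE — the smallest open CROSS-partner instance of O2, typed (planner p3 g23; memo `r24/CORE-BOUND-NOTES.md` §14.29 (Rc), §14.30)

FRONTIER range-avoidance ladder, rung F-N3, ROUND 25 (cell `pnp-ideate`).  Restricted-model proof complexity; nothing here bears on `P` versus `NP`.

TAXONOMY (§14.29): a `hun`-violation of a terminal pair `(w₁, w₂)` is a monomial `g` touching a private AND variable `p` of a chord `e ∈ J₀ ∖ F`; its other
variable `q` is AND-typed (`Typed`) and, by `SimpleOverlap`, not the other private of `e`; so `q` is (q1) OUTSIDE `J₀` (→ `PstarMultiUnion.TerminalFiveOutside`),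
(q2) an AND variable of an `F`-edge (→ `PstarUnion.TerminalFiveLit`, prover-2's chord-read chain), or (q3) a private of ANOTHER chord `f`: a **CROSS GATE**
`(p_e, p_f)`, coupling the hardness bits of two chords.

* `CrossGate` — `g` is a cross gate of `(J₀, F)`: both its AND variables are chord privates.
* `TerminalFiveCross1` (OPEN, `@[conjecture]`) — `TerminalFiveA` when EXACTLY ONE monomial violates `hun` and it is a cross gate of `w₁`
  (WLOG: `Terminal` is symmetric in `w₁, w₂`, and a gate occurring in both is removed from `w₂` by passing to `(w₁, w₁ + w₂)`).
  Expected line (§14.29 (Rc)): restricted to `{x_{p_f} = 0}` / `{x_{p_f} = 1}` the pair is a union pair whose second member reads `p_e` LINEARLY — a fibre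
  family over an INSIDE variable; Case B of the union lemma is the tool, the twist being that the fibre variable `p_f` is itself a private of the chord `f`.
-/

set_option linter.dupNamespace false -- `Summit.PneNP.PneNP.…`: summit = sub-problem name (D-0017 single-conjunct layout)

open Finset Literature.Computability.Complexity
open Summit.PneNP.PneNP.Theorems.PstarTyped (Typed)
open Summit.PneNP.PneNP.Theorems.PstarSALevel (varSet bdry BoundaryExpanding SimpleOverlap)
open Summit.PneNP.PneNP.Theorems.PstarGapOneAll (gval)
open Summit.PneNP.PneNP.Theorems.PstarCoreBound (XorClosed)
open Summit.PneNP.PneNP.Theorems.PstarChordRepair (IsChord)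
open Summit.PneNP.PneNP.Theorems.PstarChordBridgeCotree (Peelable)
open Summit.PneNP.PneNP.Theorems.PstarChordBridgeTools (privs)
open Summit.PneNP.PneNP.Theorems.PstarCoreBoundTargets (Terminal TerminalFiveA)

namespace Summit.PneNP.PneNP.Theorems.PstarCross

variable {n m : ℕ}

/-- `g` is a CROSS GATE of `(J₀, F)`: both AND variables of `g` are private AND variables of chords of `J₀ ∖ F`
(by `SimpleOverlap` they then belong to two different chords). -/
def CrossGate (I : LocalMap 4 n m) (J₀ F : Finset (Fin m)) (g : Fin m) : Prop :=
  I.vars g 2 ∈ privs I (J₀ \ F) ∧ I.vars g 3 ∈ privs I (J₀ \ F)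

/-- **TARGET (OPEN): `TerminalFiveA` with ONE cross gate.**  A terminal core with an admissible `F`, one cross gate `g₀` among the monomials of `w₁`, and
every other monomial of `w₁, w₂` avoiding the chord privates, has at most five outputs.  FRONTIER. -/
@[conjecture] def TerminalFiveCross1 : Prop :=
  ∀ (n m r : ℕ) (I : LocalMap 4 n m), I.IsPure xorAndPred → Typed I → SimpleOverlap I → BoundaryExpanding r I →
  ∀ (y : Fin m → Bool) (J₀ : Finset (Fin m)) (w₁ w₂ : Finset (Fin n) × Finset (Fin m) × Bool), Terminal I r y J₀ w₁ w₂ →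
    ∀ F ⊆ J₀, Peelable I F → (∀ F', F ⊆ F' → F' ⊆ J₀ → Peelable I F' → F' = F) → (∀ e ∈ J₀ \ F, IsChord I J₀ e) →
    ∀ g₀ ∈ w₁.2.1, CrossGate I J₀ F g₀ →
    (∀ g ∈ (w₁.2.1.erase g₀) ∪ w₂.2.1, ∀ v ∈ privs I (J₀ \ F), I.vars g 2 ≠ v ∧ I.vars g 3 ≠ v) →
    J₀.card ≤ 5

/-- `TerminalFiveCross1` is a sub-target of O2. -/
theorem terminalFiveCross1_of_terminalFiveA (h : TerminalFiveA) : TerminalFiveCross1 :=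
  fun n m r I hI hT hS hB y J₀ w₁ w₂ ht F hF hP hmax hch _ _ _ _ => h n m r I hI hT hS hB y J₀ w₁ w₂ ht F hF hP hmax hch

end Summit.PneNP.PneNP.Theorems.PstarCross
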